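import Mathlib
import Summits.MatrixMultiplication.MatrixMultiplication.Theorems.FidelityWitnessesRankTwoAdditivityPencil
import Summits.MatrixMultiplication.MatrixMultiplication.Theorems.FidelityWitnessesRankTwoAdditivityKeyRot

/-!
# `FidelityWitnesses.RankTwoAdditivity` (stmt-MatrixMultiplication-4964) — Theorem A

Existence of the interpolation parameter: for HS-orthonormal `Q` and an orthonormal pair `w` (rank-two
projector) there is `p : ℝ` with `F(φ) ≤ (1 − p)‖φ‖² + p·H(φ)` for all `φ` (`theoremA`), from the pencil lemma
and the key lemma; the degenerate case `π = 1` is handled directly with `p = 0`.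
Supports item `stmt-MatrixMultiplication-4964`; no definitions are introduced.
-/

namespace Summit.MatrixMultiplication.MatrixMultiplication.Theorems.RankTwoAdditivity

open scoped BigOperators ComplexConjugate ComplexOrder Matrix

/-- **Theorem A (existence of the interpolation parameter).** For HS-orthonormal `Q` and an orthonormal pair
`w 0, w 1 ∈ ℂ^{2×2}` there is `p : ℝ` with `F(φ) ≤ (1 − p)‖φ‖² + p·H(φ)` for every `φ : Fin 2 → κ → ℂ`, where
`F(φ) = ∑_r ‖∑_{(k,i)} conj(w r (k,i)) Q_k* φ_i‖²` and `H(φ) = Re ∑_{ij} π_ij ⟨φ_i, φ_j⟩`, `π = Tr₁ Π`.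
(Pencil lemma + key lemma; the degenerate case `π = 1` is direct.) -/
theorem theoremA {κ μ : Type*} [Fintype κ] [Fintype μ] [DecidableEq κ]
    (Q : Fin 2 → κ × μ → ℂ) (hQ : ∀ k l, (∑ c, conj (Q k c) * Q l c) = if k = l then 1 else 0)
    (w : Fin 2 → Fin 2 × Fin 2 → ℂ) (hw : ∀ r s, (∑ a, conj (w r a) * w s a) = if r = s then 1 else 0) :
    ∃ p : ℝ, ∀ φ : Fin 2 → κ → ℂ,
      (∑ r, ∑ c, ‖∑ a : Fin 2 × Fin 2, conj (w r a) * ∑ m, conj (Q a.1 (m, c)) * φ a.2 m‖ ^ 2)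
        ≤ (1 - p) * (∑ i, ∑ m, ‖φ i m‖ ^ 2)
          + p * (∑ i, ∑ j, (∑ r, ∑ k, w r (k, i) * conj (w r (k, j))) * ∑ m, conj (φ i m) * φ j m).re := by
  -- the linear map φ ↦ G_r(φ)
  set Gf : (Fin 2 → κ → ℂ) → Fin 2 → μ → ℂ :=
    fun φ r c => ∑ a : Fin 2 × Fin 2, conj (w r a) * ∑ m, conj (Q a.1 (m, c)) * φ a.2 m with hGf
  set π : Fin 2 → Fin 2 → ℂ := fun i j => ∑ r, ∑ k, w r (k, i) * conj (w r (k, j)) with hπ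
  set SE : (Fin 2 → κ → ℂ) → (Fin 2 → κ → ℂ) → ℂ :=
    fun φ ψ => (∑ r, ∑ c, conj (Gf φ r c) * Gf ψ r c) - ∑ i, ∑ m, conj (φ i m) * ψ i m with hSE
  set SG : (Fin 2 → κ → ℂ) → (Fin 2 → κ → ℂ) → ℂ :=
    fun φ ψ => (∑ i, ∑ j, π i j * ∑ m, conj (φ i m) * ψ j m) - ∑ i, ∑ m, conj (φ i m) * ψ i m with hSG
  -- linearity of Gf
  have hGlin : ∀ (α : ℂ) (v u : Fin 2 → κ → ℂ) r c, Gf (α • v + u) r c = α * Gf v r c + Gf u r c := by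
    intro α v u r c
    simp only [hGf, Pi.add_apply, Pi.smul_apply, smul_eq_mul, mul_add, Finset.sum_add_distrib, Finset.mul_sum]
    congr 1
    exact Finset.sum_congr rfl fun a _ => Finset.sum_congr rfl fun m _ => by ring
  -- diagonal values
  have hSEdiag : ∀ φ, (SE φ φ).re
      = (∑ r, ∑ c, ‖Gf φ r c‖ ^ 2) - ∑ i, ∑ m, ‖φ i m‖ ^ 2 := by
    intro φ
    simp only [hSE, Complex.sub_re, Complex.re_sum, Complex.conj_mul', ← Complex.ofReal_pow, Complex.ofReal_re]
  have hSGdiag : ∀ φ, (SG φ φ).re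
      = (∑ i, ∑ j, π i j * ∑ m, conj (φ i m) * φ j m).re - ∑ i, ∑ m, ‖φ i m‖ ^ 2 := by
    intro φ
    simp only [hSG, Complex.sub_re]
    congr 1
    simp only [Complex.re_sum, Complex.conj_mul', ← Complex.ofReal_pow, Complex.ofReal_re]
  -- the slice hypothesis from the key lemma
  have hslice : ∀ v, (SG v v).re = 0 → (SE v v).re ≤ 0 := by
    intro v hv
    rw [hSGdiag, sub_eq_zero] at hv
    rw [hSEdiag, sub_nonpos]
    exact key_lemma Q hQ w hw v hv
  -- the goal from a pencil bound
  have finish : ∀ p : ℝ, (∀ v, (SE v v).re ≤ p * (SG v v).re) →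
      ∀ φ : Fin 2 → κ → ℂ,
        (∑ r, ∑ c, ‖∑ a : Fin 2 × Fin 2, conj (w r a) * ∑ m, conj (Q a.1 (m, c)) * φ a.2 m‖ ^ 2)
          ≤ (1 - p) * (∑ i, ∑ m, ‖φ i m‖ ^ 2)
            + p * (∑ i, ∑ j, (∑ r, ∑ k, w r (k, i) * conj (w r (k, j))) * ∑ m, conj (φ i m) * φ j m).re := by
    intro p hp φ
    have h := hp φ
    rw [hSEdiag, hSGdiag] at h
    have : (∑ r, ∑ c, ‖Gf φ r c‖ ^ 2)
        = ∑ r, ∑ c, ‖∑ a : Fin 2 × Fin 2, conj (w r a) * ∑ m, conj (Q a.1 (m, c)) * φ a.2 m‖ ^ 2 := rfl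
    rw [this] at h
    linarith
  -- sesquilinearity and Hermitian symmetry of SE and SG
  have ipadd₁ : ∀ (α : ℂ) (v u x : Fin 2 → κ → ℂ),
      (∑ i, ∑ m, conj ((α • v + u) i m) * x i m)
        = conj α * (∑ i, ∑ m, conj (v i m) * x i m) + ∑ i, ∑ m, conj (u i m) * x i m := by
    intro α v u x
    simp only [Pi.add_apply, Pi.smul_apply, smul_eq_mul, map_add, map_mul, add_mul, Finset.sum_add_distrib,
      Finset.mul_sum, mul_assoc]
  have ipadd₂ : ∀ (α : ℂ) (v u x : Fin 2 → κ → ℂ),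
      (∑ i, ∑ m, conj (x i m) * (α • v + u) i m)
        = α * (∑ i, ∑ m, conj (x i m) * v i m) + ∑ i, ∑ m, conj (x i m) * u i m := by
    intro α v u x
    simp only [Pi.add_apply, Pi.smul_apply, smul_eq_mul, mul_add, Finset.sum_add_distrib, Finset.mul_sum]
    congr 1
    exact Finset.sum_congr rfl fun i _ => Finset.sum_congr rfl fun m _ => by ring
  have ipconj : ∀ (v u : Fin 2 → κ → ℂ), (∑ i, ∑ m, conj (u i m) * v i m) = conj (∑ i, ∑ m, conj (v i m) * u i m) := by
    intro v u
    simp only [map_sum, map_mul, Complex.conj_conj]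
    exact Finset.sum_congr rfl fun i _ => Finset.sum_congr rfl fun m _ => mul_comm _ _
  have hE₁ : ∀ (α : ℂ) (v u x : Fin 2 → κ → ℂ), SE (α • v + u) x = conj α * SE v x + SE u x := by
    intro α v u x
    simp only [hSE]
    rw [ipadd₁]
    have : (∑ r, ∑ c, conj (Gf (α • v + u) r c) * Gf x r c)
        = conj α * (∑ r, ∑ c, conj (Gf v r c) * Gf x r c) + ∑ r, ∑ c, conj (Gf u r c) * Gf x r c := by
      simp only [hGlin, map_add, map_mul, add_mul, Finset.sum_add_distrib, Finset.mul_sum, mul_assoc]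
    rw [this]; ring
  have hE₂ : ∀ (α : ℂ) (v u x : Fin 2 → κ → ℂ), SE x (α • v + u) = α * SE x v + SE x u := by
    intro α v u x
    simp only [hSE]
    rw [ipadd₂]
    have : (∑ r, ∑ c, conj (Gf x r c) * Gf (α • v + u) r c)
        = α * (∑ r, ∑ c, conj (Gf x r c) * Gf v r c) + ∑ r, ∑ c, conj (Gf x r c) * Gf u r c := by
      simp only [hGlin, mul_add, Finset.sum_add_distrib, Finset.mul_sum]
      congr 1
      exact Finset.sum_congr rfl fun r _ => Finset.sum_congr rfl fun c _ => by ring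
    rw [this]; ring
  have hEh : ∀ v u : Fin 2 → κ → ℂ, SE u v = conj (SE v u) := by
    intro v u
    simp only [hSE, map_sub]
    rw [ipconj v u]
    congr 1
    simp only [map_sum, map_mul, Complex.conj_conj]
    exact Finset.sum_congr rfl fun r _ => Finset.sum_congr rfl fun c _ => mul_comm _ _
  have πadd₁ : ∀ (α : ℂ) (v u x : Fin 2 → κ → ℂ),
      (∑ i, ∑ j, π i j * ∑ m, conj ((α • v + u) i m) * x j m)
        = conj α * (∑ i, ∑ j, π i j * ∑ m, conj (v i m) * x j m) + ∑ i, ∑ j, π i j * ∑ m, conj (u i m) * x j m := by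
    intro α v u x
    simp only [Pi.add_apply, Pi.smul_apply, smul_eq_mul, map_add, map_mul, add_mul, Finset.sum_add_distrib,
      Finset.mul_sum, mul_add]
    congr 1
    exact Finset.sum_congr rfl fun i _ => Finset.sum_congr rfl fun j _ => Finset.sum_congr rfl fun m _ => by ring
  have πadd₂ : ∀ (α : ℂ) (v u x : Fin 2 → κ → ℂ),
      (∑ i, ∑ j, π i j * ∑ m, conj (x i m) * (α • v + u) j m)
        = α * (∑ i, ∑ j, π i j * ∑ m, conj (x i m) * v j m) + ∑ i, ∑ j, π i j * ∑ m, conj (x i m) * u j m := by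
    intro α v u x
    simp only [Pi.add_apply, Pi.smul_apply, smul_eq_mul, mul_add, Finset.sum_add_distrib, Finset.mul_sum]
    congr 1
    exact Finset.sum_congr rfl fun i _ => Finset.sum_congr rfl fun j _ => Finset.sum_congr rfl fun m _ => by ring
  have hπherm : ∀ i j, π j i = conj (π i j) := by
    intro i j
    simp only [hπ, map_sum, map_mul, Complex.conj_conj]
    exact Finset.sum_congr rfl fun r _ => Finset.sum_congr rfl fun k _ => mul_comm _ _
  have πconj : ∀ (v u : Fin 2 → κ → ℂ),
      (∑ i, ∑ j, π i j * ∑ m, conj (u i m) * v j m) = conj (∑ i, ∑ j, π i j * ∑ m, conj (v i m) * u j m) := by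
    intro v u
    rw [map_sum, Finset.sum_comm]
    refine Finset.sum_congr rfl fun i _ => ?_
    rw [map_sum]
    refine Finset.sum_congr rfl fun j _ => ?_
    rw [map_mul, ← hπherm i j, map_sum]
    congr 1
    exact Finset.sum_congr rfl fun m _ => by rw [map_mul, Complex.conj_conj, mul_comm]
  have hG₁ : ∀ (α : ℂ) (v u x : Fin 2 → κ → ℂ), SG (α • v + u) x = conj α * SG v x + SG u x := by
    intro α v u x
    simp only [hSG]
    rw [ipadd₁, πadd₁]; ring
  have hG₂ : ∀ (α : ℂ) (v u x : Fin 2 → κ → ℂ), SG x (α • v + u) = α * SG x v + SG x u := by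
    intro α v u x
    simp only [hSG]
    rw [ipadd₂, πadd₂]; ring
  have hGh : ∀ v u : Fin 2 → κ → ℂ, SG u v = conj (SG v u) := by
    intro v u
    simp only [hSG, map_sub]
    rw [ipconj v u, πconj v u]
  -- main case: the pencil lemma applies
  by_cases hboth : (∃ v, 0 < (SG v v).re) ∧ (∃ v, (SG v v).re < 0)
  · obtain ⟨p, hp⟩ := pencil_lemma SE SG hE₁ hE₂ hEh hG₁ hG₂ hGh hslice hboth.1 hboth.2
    exact ⟨p, finish p hp⟩
  -- degenerate case: SG vanishes identically, take p = 0
  refine ⟨0, finish 0 fun v => ?_⟩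
  rw [zero_mul]
  apply hslice
  -- it remains to show (SG v v).re = 0
  obtain ⟨hw₀, hw₁, hw₀₁, hπsum⟩ := orthonormal_pair_facts w hw
  have hπre : ∀ i, π i i = ((∑ r, ∑ k, ‖w r (k, i)‖ ^ 2 : ℝ) : ℂ) := by
    intro i; simp only [hπ]; push_cast
    exact Finset.sum_congr rfl fun r _ => Finset.sum_congr rfl fun k _ => by rw [Complex.mul_conj']
  set p₀ : ℝ := ∑ r, ∑ k, ‖w r (k, 0)‖ ^ 2 with hp₀
  set p₁ : ℝ := ∑ r, ∑ k, ‖w r (k, 1)‖ ^ 2 with hp₁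
  have hπre0 : π 0 0 = (p₀ : ℂ) := hπre 0
  have hπre1 : π 1 1 = (p₁ : ℂ) := hπre 1
  have t1 : ∀ (x : ℝ) (u : κ → ℂ), ((x : ℂ) * ∑ m, conj (u m) * u m).re = x * ∑ m, ‖u m‖ ^ 2 := by
    intro x u
    have : (∑ m, conj (u m) * u m) = ((∑ m, ‖u m‖ ^ 2 : ℝ) : ℂ) := by
      push_cast; exact Finset.sum_congr rfl fun m _ => by rw [Complex.conj_mul']
    rw [this, ← Complex.ofReal_mul, Complex.ofReal_re]
  -- one-sided sign information
  have hsign : (∀ u, (SG u u).re ≤ 0) ∨ (∀ u, 0 ≤ (SG u u).re) := by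
    by_cases h1 : ∃ u, 0 < (SG u u).re
    · right; intro u
      by_contra hneg
      push Not at hneg
      exact hboth ⟨h1, ⟨u, hneg⟩⟩
    · left; intro u
      push Not at h1
      exact h1 u
  rcases isEmpty_or_nonempty κ with hκ | ⟨⟨m₀⟩⟩
  · -- no coordinates: everything vanishes
    rw [hSGdiag]
    simp
  · -- test vectors χ ⊗ δ_{m₀}
    have htest : ∀ χ : Fin 2 → ℂ, (SG (fun i m => if m = m₀ then χ i else 0) (fun i m => if m = m₀ then χ i else 0)).re
        = (∑ i, ∑ j, π i j * (conj (χ i) * χ j)).re - ∑ i, ‖χ i‖ ^ 2 := by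
      intro χ
      rw [hSGdiag]
      have e1 : ∀ i j, (∑ m, conj ((fun i m => if m = m₀ then χ i else (0:ℂ)) i m) * (fun i m => if m = m₀ then χ i else (0:ℂ)) j m)
          = conj (χ i) * χ j := by
        intro i j
        simp only
        rw [Finset.sum_eq_single m₀]
        · simp
        · intro m _ hm; simp [hm]
        · intro h; exact absurd (Finset.mem_univ m₀) h
      have e2 : ∀ i, (∑ m, ‖(fun i m => if m = m₀ then χ i else (0:ℂ)) i m‖ ^ 2) = ‖χ i‖ ^ 2 := by
        intro i
        simp only
        rw [Finset.sum_eq_single m₀]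
        · simp
        · intro m _ hm; simp [hm]
        · intro h; exact absurd (Finset.mem_univ m₀) h
      simp only [e1, e2]
    -- evaluate at e₀, e₁ and (1,u)
    have val : ∀ χ : Fin 2 → ℂ, (∑ i, ∑ j, π i j * (conj (χ i) * χ j)).re - ∑ i, ‖χ i‖ ^ 2
        = (p₀ - 1) * ‖χ 0‖ ^ 2 + (p₁ - 1) * ‖χ 1‖ ^ 2
          + 2 * (π 0 1 * (conj (χ 0) * χ 1)).re := by
      intro χ
      simp only [Fin.sum_univ_two, Complex.add_re]
      rw [hπre0, hπre1, hπherm 0 1]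
      have t1 : ∀ (x : ℝ) (z : ℂ), ((x : ℂ) * (conj z * z)).re = x * ‖z‖ ^ 2 := by
        intro x z; rw [Complex.conj_mul', ← Complex.ofReal_pow, ← Complex.ofReal_mul, Complex.ofReal_re]
      have t2 : (conj (π 0 1) * (conj (χ 1) * χ 0)).re = (π 0 1 * (conj (χ 0) * χ 1)).re := by
        have : conj (π 0 1) * (conj (χ 1) * χ 0) = conj (π 0 1 * (conj (χ 0) * χ 1)) := by
          simp only [map_mul, Complex.conj_conj]; ring
        rw [this, Complex.conj_re]
      rw [t1, t1, t2]
      ring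
    set a₀ : ℝ := p₀ - 1 with ha₀
    set a₁ : ℝ := p₁ - 1 with ha₁
    have hsum01 : a₀ + a₁ = 0 := by rw [ha₀, ha₁]; linarith
    have hval : ∀ χ : Fin 2 → ℂ, (SG (fun i m => if m = m₀ then χ i else 0) (fun i m => if m = m₀ then χ i else 0)).re
        = a₀ * ‖χ 0‖ ^ 2 + a₁ * ‖χ 1‖ ^ 2 + 2 * (π 0 1 * (conj (χ 0) * χ 1)).re := by
      intro χ; rw [htest, val]
    -- e₀ and e₁
    have v0 := hval (fun i => if i = 0 then 1 else 0)
    have v1 := hval (fun i => if i = 1 then 1 else 0)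
    simp only [if_true, show ((1 : Fin 2) = 0) = False from by decide, show ((0 : Fin 2) = 1) = False from by decide,
      if_false, norm_one, norm_zero, one_pow, mul_one, map_one, map_zero, mul_zero,
      Complex.zero_re, add_zero, zero_pow two_ne_zero] at v0 v1
    -- u-direction
    have vu := hval (fun i => if i = 0 then 1 else conj (π 0 1))
    have vu' := hval (fun i => if i = 0 then 1 else -conj (π 0 1))
    simp only [if_true, show ((1 : Fin 2) = 0) = False from by decide, if_false, norm_one, one_pow, mul_one,
      map_one, one_mul, norm_neg, Complex.norm_conj, Complex.mul_conj', mul_neg, Complex.neg_re,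
      ← Complex.ofReal_pow, Complex.ofReal_re] at vu vu'
    -- the four sign constraints
    have c0 : ∀ (hs : (∀ u, (SG u u).re ≤ 0) ∨ (∀ u, 0 ≤ (SG u u).re)),
        (a₀ ≤ 0 ∧ a₁ ≤ 0 ∧ a₀ + a₁ * ‖π 0 1‖ ^ 2 + 2 * ‖π 0 1‖ ^ 2 ≤ 0)
        ∨ (0 ≤ a₀ ∧ 0 ≤ a₁ ∧ 0 ≤ a₀ + a₁ * ‖π 0 1‖ ^ 2 + -(2 * ‖π 0 1‖ ^ 2)) := by
      intro hs
      rcases hs with hs | hs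
      · left
        refine ⟨?_, ?_, ?_⟩
        · have := hs (fun i m => if m = m₀ then (if i = 0 then (1 : ℂ) else 0) else 0); rwa [v0] at this
        · have := hs (fun i m => if m = m₀ then (if i = 1 then (1 : ℂ) else 0) else 0); rw [v1] at this; linarith
        · have := hs (fun i m => if m = m₀ then (if i = 0 then (1 : ℂ) else conj (π 0 1)) else 0); rwa [vu] at this
      · right
        refine ⟨?_, ?_, ?_⟩
        · have := hs (fun i m => if m = m₀ then (if i = 0 then (1 : ℂ) else 0) else 0); rwa [v0] at this
        · have := hs (fun i m => if m = m₀ then (if i = 1 then (1 : ℂ) else 0) else 0); rw [v1] at this; linarith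
        · have := hs (fun i m => if m = m₀ then (if i = 0 then (1 : ℂ) else -conj (π 0 1)) else 0); rwa [vu'] at this
    have hfacts : a₀ = 0 ∧ a₁ = 0 ∧ ‖π 0 1‖ ^ 2 = 0 := by
      rcases c0 hsign with ⟨h0, h1, h2⟩ | ⟨h0, h1, h2⟩
      · have e0 : a₀ = 0 := by linarith
        have e1 : a₁ = 0 := by linarith
        rw [e0, e1] at h2
        exact ⟨e0, e1, by nlinarith [sq_nonneg ‖π 0 1‖]⟩
      · have e0 : a₀ = 0 := by linarith
        have e1 : a₁ = 0 := by linarith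
        rw [e0, e1] at h2
        exact ⟨e0, e1, by nlinarith [sq_nonneg ‖π 0 1‖]⟩
    obtain ⟨ha0, ha1, hz⟩ := hfacts
    have hπ01 : π 0 1 = 0 := norm_eq_zero.1 ((pow_eq_zero_iff two_ne_zero).1 hz)
    -- hence SG v v = 0 for every v
    rw [hSGdiag]
    simp only [Fin.sum_univ_two, Complex.add_re, hπherm 0 1, hπ01, map_zero, zero_mul,
      add_zero, zero_add, hπre0, hπre1, t1]
    have e0 : p₀ = 1 := by linarith
    have e1 : p₁ = 1 := by linarith
    rw [e0, e1]; ring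

end Summit.MatrixMultiplication.MatrixMultiplication.Theorems.RankTwoAdditivity
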